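import Summits.MatrixMultiplication.OmegaCensus.BoxRatioSectionLaw
import Summits.MatrixMultiplication.OmegaCensus.CentreIndexSixGroups

/-!
# ω-census, family (b3): conjecture C9 (c), the class `[G:Z(G)] = 6` in the kernel — centre-index-6 groups are box-useful

HONEST FRAMING (pub-omega census; verbatim): lottery ticket; floor = certified bounds/negative ranges.  Census BOOKKEEPING for
the typed conjecture C9 (`BoxRatioSectionLaw.lean`): `BoxUseful.of_index_center_six`, the converse direction for the class
`[G:Z(G)] = 6`; nothing here is progress on `ω`.

The kernel law NR154 (`CentreIndexSix.three_mul_volume_le`, `3|S||T||U| ≤ 5|G|` for TPP triples with `|T|, |U| ≤ 3`) is a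
statement about TPP boxes; its proof (`fibre_le_five` + double counting over the fibres `key P · K`) uses the TPP hypothesis
only to know that two DISTINCT cells have non-trivial word in both orders — i.e. that the cell set is independent.  This file
re-runs the same proof for an arbitrary independent cell set `I ⊆ G × Y × W` (`fibre_le_five_indep`,
`three_mul_card_indep_le_basic`: `3|I| ≤ 5|G|` when `1 ∈ Y`, `1 ∈ W`), normalises a general box by right translation of `Y`
and `W` (the cell word is unchanged), and concludes `5|I| < 9|G|` from `3|I| ≤ 5|G|` via `CentreIndexSix.exists_coord`.
-/

namespace Summit.MatrixMultiplication.OmegaCensus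

open Finset ProductBoxBound

namespace CentreIndexSix

variable {G : Type*} [Group G]

namespace Coord

variable {c : G} {κ ε : G → ZMod 3} (h : Coord c κ ε)
include h

/-- **Fibre lemma for INDEPENDENT cell sets** (the box form of `fibre_le_five`: the TPP hypothesis there is used only to
know that two distinct cells have non-trivial word in both orders, which is what independence says).  With `T ⊆ {1, t₁, t₂}`,
`U ⊆ {1, u₁, u₂}`, at most `5` independent cells with second/third coordinates in `T`/`U` lie in one fibre
`{P : g⁻¹ · key P ∈ K}`. [folklore] -/
theorem fibre_le_five_indep [DecidableEq G] {T U : Finset G} {t₁ t₂ u₁ u₂ : G}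
    (hT : ∀ y ∈ T, y = 1 ∨ y = t₁ ∨ y = t₂) (hU : ∀ w ∈ U, w = 1 ∨ w = u₁ ∨ w = u₂) (h12 : lab κ ε t₁ ≤ lab κ ε t₂)
    (h34 : lab κ ε u₁ ≤ lab κ ε u₂) (g : G) {J : Finset (G × G × G)} (hJT : ∀ P ∈ J, P.2.1 ∈ T) (hJU : ∀ P ∈ J, P.2.2 ∈ U)
    (hind : ∀ P ∈ J, ∀ P' ∈ J, P ≠ P' → E P P' ≠ 1)
    (hJg : ∀ P ∈ J, InK c (g⁻¹ * key P)) : #J ≤ 5 := by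
  classical
  -- the configuration
  have hl1 := lab_lt κ ε t₁; have hl2 := lab_lt κ ε t₂; have hl3 := lab_lt κ ε u₁; have hl4 := lab_lt κ ε u₂
  set n : ℕ := lab κ ε t₁ + 6 * lab κ ε t₂ + 36 * lab κ ε u₁ + 216 * lab κ ε u₂ with hn
  have hn' : n < 1296 := by omega
  have hsort : sorted n = true := by
    simp only [sorted, Bool.and_eq_true, decide_eq_true_eq]; omega
  have hT1 : labT n 1 = lab κ ε t₁ := by simp [labT]; omega
  have hT2 : labT n 2 = lab κ ε t₂ := by simp [labT]; omega
  have hU1 : labU n 1 = lab κ ε u₁ := by simp [labU]; omega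
  have hU2 : labU n 2 = lab κ ε u₂ := by simp [labU]; omega
  have hT0 : labT n 0 = lab κ ε 1 := by rw [h.lab_one]; simp [labT]
  have hU0 : labU n 0 = lab κ ε 1 := by rw [h.lab_one]; simp [labU]
  -- position indices
  let iT : G → ℕ := fun y => if y = 1 then 0 else if y = t₁ then 1 else 2
  let iU : G → ℕ := fun w => if w = 1 then 0 else if w = u₁ then 1 else 2
  have selT : ∀ y ∈ T, (iT y = 0 ∧ y = 1) ∨ (iT y = 1 ∧ y = t₁) ∨ (iT y = 2 ∧ y = t₂) := by
    intro y hy; simp only [iT]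
    split_ifs with h1 h2
    · exact Or.inl ⟨rfl, h1⟩
    · exact Or.inr (Or.inl ⟨rfl, h2⟩)
    · rcases hT y hy with e | e | e
      · exact absurd e h1
      · exact absurd e h2
      · exact Or.inr (Or.inr ⟨rfl, e⟩)
  have selU : ∀ w ∈ U, (iU w = 0 ∧ w = 1) ∨ (iU w = 1 ∧ w = u₁) ∨ (iU w = 2 ∧ w = u₂) := by
    intro w hw; simp only [iU]
    split_ifs with h1 h2
    · exact Or.inl ⟨rfl, h1⟩
    · exact Or.inr (Or.inl ⟨rfl, h2⟩)
    · rcases hU w hw with e | e | e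
      · exact absurd e h1
      · exact absurd e h2
      · exact Or.inr (Or.inr ⟨rfl, e⟩)
  have labT_iT : ∀ y ∈ T, iT y < 3 ∧ labT n (iT y) = lab κ ε y := by
    intro y hy
    rcases selT y hy with ⟨e, rfl⟩ | ⟨e, rfl⟩ | ⟨e, rfl⟩ <;> rw [e]
    exacts [⟨by omega, hT0⟩, ⟨by omega, hT1⟩, ⟨by omega, hT2⟩]
  have labU_iU : ∀ w ∈ U, iU w < 3 ∧ labU n (iU w) = lab κ ε w := by
    intro w hw
    rcases selU w hw with ⟨e, rfl⟩ | ⟨e, rfl⟩ | ⟨e, rfl⟩ <;> rw [e]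
    exacts [⟨by omega, hU0⟩, ⟨by omega, hU1⟩, ⟨by omega, hU2⟩]
  have injT : ∀ y ∈ T, ∀ y' ∈ T, iT y = iT y' → y = y' := by
    intro y hy y' hy' e
    rcases selT y hy with ⟨e1, f1⟩ | ⟨e1, f1⟩ | ⟨e1, f1⟩ <;>
      rcases selT y' hy' with ⟨e2, f2⟩ | ⟨e2, f2⟩ | ⟨e2, f2⟩ <;> first | (rw [f1, f2]; done) | omega
  have injU : ∀ w ∈ U, ∀ w' ∈ U, iU w = iU w' → w = w' := by
    intro w hw w' hw' e
    rcases selU w hw with ⟨e1, f1⟩ | ⟨e1, f1⟩ | ⟨e1, f1⟩ <;>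
      rcases selU w' hw' with ⟨e2, f2⟩ | ⟨e2, f2⟩ | ⟨e2, f2⟩ <;> first | (rw [f1, f2]; done) | omega
  -- the vertex map
  let lam : G × G × G → ZMod 3 := fun P => ε P.2.1 * ε P.2.2 * κ P.1
  let φ : G × G × G → ℕ := fun P => 3 * (3 * iT P.2.1 + iU P.2.2) + (lam P).val
  have memV : ∀ P ∈ J, True ∧ P.2.1 ∈ T ∧ P.2.2 ∈ U := fun P hP => ⟨trivial, hJT P hP, hJU P hP⟩
  have φdiv : ∀ P ∈ J, φ P < 27 ∧ φ P / 3 / 3 = iT P.2.1 ∧ φ P / 3 % 3 = iU P.2.2 ∧ φ P % 3 = (lam P).val := by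
    intro P hP
    obtain ⟨-, hy, hw⟩ := memV P hP
    have h1 := (labT_iT _ hy).1; have h2 := (labU_iU _ hw).1; have h3 := (lam P).val_lt
    simp only [φ]; omega
  -- independence: a flagged pair of distinct cells contradicts the TPP
  have indep : ∀ P ∈ J, ∀ P' ∈ J, P ≠ P' → (adjRow (packAdj n) (φ P)).testBit (φ P') = false := by
    rintro ⟨x, y, w⟩ hP ⟨x', y', w'⟩ hP' hne
    rw [Bool.eq_false_iff]
    intro hbit
    obtain ⟨-, hyT, hwU⟩ := memV _ hP
    obtain ⟨-, hyT', hwU'⟩ := memV _ hP'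
    obtain ⟨-, hpos, hcase⟩ := adj_spec hbit
    obtain ⟨-, d1, d2, d3⟩ := φdiv _ hP
    obtain ⟨-, d1', d2', d3'⟩ := φdiv _ hP'
    simp only at d1 d2 d3 d1' d2' d3'
    rw [dpp, dpp, d1, d2, d3, d1', d2', d3', (labT_iT y hyT).2, (labT_iT y' hyT').2, (labU_iU w hwU).2,
      (labU_iU w' hwU').2] at hcase
    have hu := hJg _ hP; have hu' := hJg _ hP'
    simp only [key] at hu hu'
    have h3 : (3 : ZMod 3) = 0 := by decide
    rcases hcase with e | e
    · -- `λ' ≡ λ − σ' B`: the word `E(P, P')` has exponent `0`, hence is trivial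
      have hd := dn_cast _ (lab_lt κ ε y) _ (lab_lt κ ε y') _ (lab_lt κ ε w) _ (lab_lt κ ε w')
      rw [kOf_lab, kOf_lab, kOf_lab, kOf_lab, h.eOf_lab, h.eOf_lab, h.eOf_lab, h.eOf_lab] at hd
      have el : lam (x', y', w') = lam (x, y, w) + 2 * ((dn (lab κ ε y) (lab κ ε y') (lab κ ε w) (lab κ ε w') : ℕ) : ZMod 3) := by
        rw [← ZMod.natCast_zmod_val (lam (x', y', w')), e, ZMod.natCast_mod]; push_cast; rw [ZMod.natCast_zmod_val]
      rw [hd] at el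
      simp only [lam] at el
      have hk : κ (E (x, y, w) (x', y', w')) = 0 := by
        rw [h.kap_E_fibre hu hu', el]; linear_combination (ε y * ε w * (ε y' * ε w') *
          (κ y - ε y * ε y' * κ y' + ε y * ε y' * (κ w - ε w * ε w' * κ w'))) * h3
      have hE := h.inK_eq_one (h.inK_E hu hu') hk
      exact hind _ hP _ hP' hne hE
    · -- `λ' ≡ λ + d(p', p)`: the word `E(P', P)` is trivial
      have hd := dn_cast _ (lab_lt κ ε y') _ (lab_lt κ ε y) _ (lab_lt κ ε w') _ (lab_lt κ ε w)
      rw [kOf_lab, kOf_lab, kOf_lab, kOf_lab, h.eOf_lab, h.eOf_lab, h.eOf_lab, h.eOf_lab] at hd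
      have el : lam (x', y', w') = lam (x, y, w) + ((dn (lab κ ε y') (lab κ ε y) (lab κ ε w') (lab κ ε w) : ℕ) : ZMod 3) := by
        rw [← ZMod.natCast_zmod_val (lam (x', y', w')), e, ZMod.natCast_mod]; push_cast; rw [ZMod.natCast_zmod_val]
      rw [hd] at el
      simp only [lam] at el
      have hk : κ (E (x', y', w') (x, y, w)) = 0 := by
        rw [h.kap_E_fibre hu' hu, el]; ring
      have hE := h.inK_eq_one (h.inK_E hu' hu) hk
      exact hind _ hP' _ hP (Ne.symm hne) hE
  -- injectivity: position and normalised lift determine the cell inside a fibre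
  have inj : Set.InjOn φ J := by
    rintro ⟨x, y, w⟩ hP ⟨x', y', w'⟩ hP' e
    obtain ⟨-, hyT, hwU⟩ := memV _ hP
    obtain ⟨-, hyT', hwU'⟩ := memV _ hP'
    obtain ⟨-, d1, d2, d3⟩ := φdiv _ hP
    obtain ⟨-, d1', d2', d3'⟩ := φdiv _ hP'
    simp only at d1 d2 d3 d1' d2' d3' e
    have ey : y = y' := injT y hyT y' hyT' (by rw [← d1, ← d1', e])
    have ew : w = w' := injU w hwU w' hwU' (by rw [← d2, ← d2', e])
    subst ey ew
    have el : lam (x, y, w) = lam (x', y, w) := ZMod.val_injective 3 (by rw [← d3, ← d3', e])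
    simp only [lam] at el
    have hκ : κ x = κ x' := by
      linear_combination (ε y * ε w) * el + (-(ε w * ε w * (κ x - κ x'))) * h.eps_sq y + (-(κ x - κ x')) * h.eps_sq w
    have hu := hJg _ hP; have hu' := hJg _ hP'
    simp only [key] at hu hu'
    have hεx : ε x = ε x' := by rw [h.eps_of_fibre hu, h.eps_of_fibre hu']
    have e1 : κ (g⁻¹ * (x * y * w)) = κ g⁻¹ + ε g⁻¹ * (κ x + ε x * κ y + ε x * ε y * κ w) := by
      simp only [h.kap_mul, h.eps_mul]
    have e2 : κ (g⁻¹ * (x' * y * w)) = κ g⁻¹ + ε g⁻¹ * (κ x' + ε x' * κ y + ε x' * ε y * κ w) := by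
      simp only [h.kap_mul, h.eps_mul]
    rw [hκ, hεx, ← e2] at e1
    have := mul_left_cancel (h.inK_eq_of_kap hu hu' e1)
    rw [mul_right_cancel (mul_right_cancel this)]
  -- count through the certificate
  have hI := indep_card_le_five hn' hsort (J.image φ)
    (by
      intro a ha b hb hab
      obtain ⟨P, hP, rfl⟩ := mem_image.1 ha
      obtain ⟨P', hP', rfl⟩ := mem_image.1 hb
      exact indep P hP P' hP' fun e => hab (by rw [e]))
    (by
      intro a ha
      obtain ⟨P, hP, rfl⟩ := mem_image.1 ha
      exact (φdiv P hP).1)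
  rwa [card_image_of_injOn inj] at hI

/-- **Box form of `three_mul_volume_le_basic`.**  With coordinates `Coord c κ ε` and `1 ∈ T`, `1 ∈ U`, `#T, #U ≤ 3`, every
independent cell set `V ⊆ G × T × U` has `3·|V| ≤ 5·|G|` (each cell counted at the three points of `key P · K`, at most five
cells per fibre by `fibre_le_five_indep`). [folklore] -/
theorem three_mul_card_indep_le_basic [Fintype G] [DecidableEq G] {T U : Finset G} (hT : #T ≤ 3) (hU : #U ≤ 3)
    (h1T : (1 : G) ∈ T) (h1U : (1 : G) ∈ U) {V : Finset (G × G × G)} (hVb : V ⊆ univ ×ˢ (T ×ˢ U))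
    (hind : ∀ P ∈ V, ∀ P' ∈ V, P ≠ P' → E P P' ≠ 1) : 3 * #V ≤ 5 * Fintype.card G := by
  classical
  -- `T ⊆ {1, t₁, t₂}`, `U ⊆ {1, u₁, u₂}` with sorted labels
  obtain ⟨t₁, t₂, hT', h12⟩ : ∃ a b : G, (∀ y ∈ T, y = 1 ∨ y = a ∨ y = b) ∧ lab κ ε a ≤ lab κ ε b := by
    obtain ⟨a, b, hab⟩ := exists_cover_three hT h1T
    rcases le_total (lab κ ε a) (lab κ ε b) with hle | hle
    · exact ⟨a, b, hab, hle⟩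
    · exact ⟨b, a, fun y hy => (hab y hy).imp_right Or.symm, hle⟩
  obtain ⟨u₁, u₂, hU', h34⟩ : ∃ a b : G, (∀ y ∈ U, y = 1 ∨ y = a ∨ y = b) ∧ lab κ ε a ≤ lab κ ε b := by
    obtain ⟨a, b, hab⟩ := exists_cover_three hU h1U
    rcases le_total (lab κ ε a) (lab κ ε b) with hle | hle
    · exact ⟨a, b, hab, hle⟩
    · exact ⟨b, a, fun y hy => (hab y hy).imp_right Or.symm, hle⟩
  let r : (G × G × G) → G → Prop := fun P g => InK c (g⁻¹ * key P)
  have hL : ∀ P ∈ V, #((univ : Finset G).bipartiteAbove r P) = 3 := by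
    intro P _
    have hset : (univ : Finset G).bipartiteAbove r P = {key P, key P * (c * c), key P * c} := by
      ext g'
      simp only [bipartiteAbove, mem_filter, mem_univ, true_and, mem_insert, mem_singleton, r, InK]
      constructor
      · rintro (e | e | e)
        · left
          calc g' = g' * 1 := (mul_one _).symm
            _ = g' * (g'⁻¹ * key P) := by rw [e]
            _ = key P := by group
        · right; left
          calc g' = key P * (g'⁻¹ * key P)⁻¹ := by group
            _ = key P * (c * c) := by rw [e, inv_eq_of_mul_eq_one_right h.c_mul_cc]
        · right; right
          calc g' = key P * (g'⁻¹ * key P)⁻¹ := by group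
            _ = key P * c := by rw [e, inv_eq_of_mul_eq_one_right h.ccc]
      · rintro (rfl | rfl | rfl)
        · left; group
        · right; left
          calc (key P * (c * c))⁻¹ * key P = (c * c)⁻¹ := by group
            _ = c := inv_eq_of_mul_eq_one_right h.ccc
        · right; right
          calc (key P * c)⁻¹ * key P = c⁻¹ := by group
            _ = c * c := inv_eq_of_mul_eq_one_right h.c_mul_cc
    rw [hset, card_insert_of_notMem, card_insert_of_notMem, card_singleton]
    · simp only [mem_singleton]
      exact fun e => h.c_ne_cc (mul_left_cancel e).symm
    · simp only [mem_insert, mem_singleton, not_or]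
      exact ⟨fun e => h.cc_ne_one (mul_left_cancel (a := key P) (by rw [mul_one]; exact e.symm)),
        fun e => h.c_ne_one (mul_left_cancel (a := key P) (by rw [mul_one]; exact e.symm))⟩
  have memV : ∀ P ∈ V, P.2.1 ∈ T ∧ P.2.2 ∈ U := fun P hP => by
    have := hVb hP; rw [mem_product, mem_product] at this; exact ⟨this.2.1, this.2.2⟩
  have hR : ∀ g ∈ (univ : Finset G), #(V.bipartiteBelow r g) ≤ 5 := fun g _ =>
    h.fibre_le_five_indep hT' hU' h12 h34 g (fun P hP => (memV P (mem_filter.1 hP).1).1)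
      (fun P hP => (memV P (mem_filter.1 hP).1).2)
      (fun P hP P' hP' hne => hind P (mem_filter.1 hP).1 P' (mem_filter.1 hP').1 hne) fun P hP => (mem_filter.1 hP).2
  calc 3 * #V = ∑ P ∈ V, #((univ : Finset G).bipartiteAbove r P) := by rw [sum_const_nat hL, mul_comm]
    _ = ∑ g ∈ (univ : Finset G), #(V.bipartiteBelow r g) := sum_card_bipartiteAbove_eq_sum_card_bipartiteBelow _
    _ ≤ ∑ g ∈ (univ : Finset G), 5 := sum_le_sum hR
    _ = 5 * Fintype.card G := by rw [sum_const, card_univ, smul_eq_mul, mul_comm]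

end Coord

end CentreIndexSix

variable {G : Type*} [Group G]

/-- Right-translating the second and third coordinates of two cells by fixed elements leaves the cell word unchanged. [folklore] -/
theorem cellWord_translate [DecidableEq G] (y₀ w₀ : G) (P P' : G × G × G) :
    cellWord (P.1, (P.2.1 * y₀⁻¹, P.2.2 * w₀⁻¹)) (P'.1, (P'.2.1 * y₀⁻¹, P'.2.2 * w₀⁻¹)) = cellWord P P' := by
  simp only [cellWord]; group

/-- **C9 (c), class `[G:Z(G)] = 6`, in the kernel.** A finite group with centre of index `6` is box-useful
(`3|I| ≤ 5|G| < (27/5)|G|`). [folklore] -/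
theorem BoxUseful.of_index_center_six [Fintype G] [DecidableEq G] (h6 : (Subgroup.center G).index = 6) :
    BoxUseful G := by
  classical
  intro Y W hY hW I hI hind
  obtain ⟨c, κ, ε, hc⟩ := CentreIndexSix.exists_coord h6
  obtain ⟨y₀, hy₀⟩ : Y.Nonempty := by rw [← Finset.card_pos, hY]; norm_num
  obtain ⟨w₀, hw₀⟩ : W.Nonempty := by rw [← Finset.card_pos, hW]; norm_num
  let τ : G × G × G → G × G × G := fun P => (P.1, (P.2.1 * y₀⁻¹, P.2.2 * w₀⁻¹))
  have τinj : Function.Injective τ := by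
    rintro ⟨x, y, w⟩ ⟨x', y', w'⟩ e
    simp only [τ, Prod.mk.injEq] at e
    obtain ⟨ex, ey, ew⟩ := e
    rw [ex, mul_right_cancel ey, mul_right_cancel ew]
  set V : Finset (G × G × G) := I.image τ with hVdef
  have hVb : V ⊆ univ ×ˢ (Y.image (· * y₀⁻¹) ×ˢ W.image (· * w₀⁻¹)) := by
    intro Q hQ
    obtain ⟨P, hP, rfl⟩ := Finset.mem_image.1 hQ
    have hPb := hI hP
    simp only [Finset.mem_product, Finset.mem_univ, true_and] at hPb
    simp only [τ, Finset.mem_product, Finset.mem_univ, true_and, Finset.mem_image]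
    exact ⟨⟨P.2.1, hPb.1, rfl⟩, ⟨P.2.2, hPb.2, rfl⟩⟩
  have hindV : ∀ Q ∈ V, ∀ Q' ∈ V, Q ≠ Q' → CentreIndexSix.E Q Q' ≠ 1 := by
    intro Q hQ Q' hQ' hne
    obtain ⟨P, hP, rfl⟩ := Finset.mem_image.1 hQ
    obtain ⟨P', hP', rfl⟩ := Finset.mem_image.1 hQ'
    have hPP : P ≠ P' := fun e => hne (by rw [e])
    have : cellWord (τ P) (τ P') = cellWord P P' := cellWord_translate y₀ w₀ P P'
    intro hE
    apply hind P hP P' hP' hPP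
    rw [← this]; exact hE
  have h1Y : (1 : G) ∈ Y.image (· * y₀⁻¹) := Finset.mem_image.2 ⟨y₀, hy₀, mul_inv_cancel y₀⟩
  have h1W : (1 : G) ∈ W.image (· * w₀⁻¹) := Finset.mem_image.2 ⟨w₀, hw₀, mul_inv_cancel w₀⟩
  have h3 := hc.three_mul_card_indep_le_basic (Finset.card_image_le.trans hY.le) (Finset.card_image_le.trans hW.le) h1Y h1W
    hVb hindV
  rw [hVdef, Finset.card_image_of_injective I τinj] at h3
  have hpos : 0 < Fintype.card G := Fintype.card_pos
  omega

end Summit.MatrixMultiplication.OmegaCensus
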